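import Mathlib

/-!
# T5LiftProjector — the linear-algebra cores of T5-ID §ID-2(b) and §ID-3(c)

Two elementary facts used by the Tier-5 identification sub-step N1 (route/T5-ID-p2.md):

* §ID-3(c): the global theta lift of a ONE-dimensional representation is the image of a linear map
  `θ : Φ →ₗ W` (linear in the Schwartz datum), so every finite sum of lifts is a single lift, and
  if an idempotent `e` on the target (a `K`-average, a `K₁`-isotypic projector) intertwines with
  an operator `e'` on the source (`e ∘ θ = θ ∘ e'`), then every `e`-fixed vector of the lift is the
  lift of an `e'`-image: `v = θ φ`, `e v = v` ⟹ `v = θ (e' φ)` (`LinearMap.exists_eq_map_of_fixed`).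
* §ID-2(b): a linear equivalence `Λ : V ≃ₗ W` intertwining endomorphisms `T_V`, `T_W`
  (`Λ ∘ T_V = T_W ∘ Λ`, the `F`-equivariance of the isogeny) maps each eigenspace of `T_V` ONTO the
  eigenspace of `T_W` with the same eigenvalue (`LinearEquiv.map_eigenspace_eq`), so a basis of the
  one is carried to a basis of the other.
-/

namespace Summit.Ventures.HodgeRepro2.T5LiftProjector

section Lift

variable {K : Type*} [Field K] {Φ W : Type*} [AddCommGroup Φ] [Module K Φ]
  [AddCommGroup W] [Module K W]

/-- A finite sum of lifts is a single lift: the range of a linear map is a submodule, so a sum of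
elements `θ φ_k` is `θ (Σ φ_k)` (T5-ID §ID-3(c), «finite sums of lifts are lifts of sums»). -/
theorem LinearMap.sum_map_mem_range (θ : Φ →ₗ[K] W) {ι : Type*} (s : Finset ι) (φ : ι → Φ) :
    ∑ k ∈ s, θ (φ k) = θ (∑ k ∈ s, φ k) := by
  rw [map_sum]

/-- If `e` is an operator on the target intertwining with `e'` on the source
(`e (θ φ) = θ (e' φ)` for all `φ`), then an `e`-fixed vector in the range of `θ` is the lift of an
`e'`-image (T5-ID §ID-3(c): a `K`-fixed vector of `K₁`-type `τ` in the lift is the lift of the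
`K`-fixed, `τ`-isotypic component of its Schwartz datum). -/
theorem LinearMap.exists_eq_map_of_fixed (θ : Φ →ₗ[K] W) (e : W →ₗ[K] W) (e' : Φ →ₗ[K] Φ)
    (h : ∀ φ, e (θ φ) = θ (e' φ)) {v : W} (hv : v ∈ LinearMap.range θ) (hfix : e v = v) :
    ∃ φ : Φ, v = θ (e' φ) := by
  obtain ⟨φ, rfl⟩ := hv
  exact ⟨φ, by rw [← h φ, hfix]⟩

end Lift

section Eigenspace

variable {K : Type*} [Field K] {V W : Type*} [AddCommGroup V] [Module K V]
  [AddCommGroup W] [Module K W]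

/-- An intertwining linear equivalence maps eigenspaces onto eigenspaces with the same eigenvalue
(T5-ID §ID-2(b): the `F`-equivariant isogeny `Λ_i` maps the `τ₁`-eigenspace of `H¹(A_{T_i}^{r_i})`
onto the `τ₁`-eigenspace of `H¹(A_{μ_i,ℂ})`). -/
theorem LinearEquiv.map_eigenspace_eq (Λ : V ≃ₗ[K] W) (T_V : Module.End K V)
    (T_W : Module.End K W) (hΛ : ∀ v, Λ (T_V v) = T_W (Λ v)) (μ : K) :
    (Module.End.eigenspace T_V μ).map (Λ : V →ₗ[K] W) = Module.End.eigenspace T_W μ := by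
  ext w
  constructor
  · rintro ⟨v, hv, rfl⟩
    have hv' : T_V v = μ • v := Module.End.mem_eigenspace_iff.1 hv
    rw [Module.End.mem_eigenspace_iff, LinearEquiv.coe_coe, ← hΛ, hv', map_smul]
  · intro hw
    have hw' : T_W w = μ • w := Module.End.mem_eigenspace_iff.1 hw
    refine ⟨Λ.symm w, ?_, by simp⟩
    show Λ.symm w ∈ Module.End.eigenspace T_V μ
    rw [Module.End.mem_eigenspace_iff]
    apply Λ.injective
    rw [hΛ, LinearEquiv.apply_symm_apply, hw', map_smul, LinearEquiv.apply_symm_apply]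

/-- The image of a basis of the eigenspace under the intertwining equivalence is a basis of the
target eigenspace: the `u_j = (pr_{i,j} ∘ Λ_i)^* e_{i,τ₁}` of T5-ID §ID-2(b) form a basis. -/
theorem LinearEquiv.span_image_eigenspace (Λ : V ≃ₗ[K] W) (T_V : Module.End K V)
    (T_W : Module.End K W) (hΛ : ∀ v, Λ (T_V v) = T_W (Λ v)) (μ : K) (s : Set V)
    (hs : Submodule.span K s = Module.End.eigenspace T_V μ) :
    Submodule.span K ((Λ : V →ₗ[K] W) '' s) = Module.End.eigenspace T_W μ := by
  rw [← Submodule.map_span, hs, LinearEquiv.map_eigenspace_eq Λ T_V T_W hΛ μ]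

end Eigenspace

end Summit.Ventures.HodgeRepro2.T5LiftProjector
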